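import Summits.HodgeConjecture.HodgeConjecture.Theorems.Ring2AbelianAllAndreInvariantLiftsIdempotent
import Summits.HodgeConjecture.HodgeConjecture.Theorems.Ring2AbelianAllAndreWeilPencilsNumerical
import HarnessLib

/-!
# Ring 2 · sub-cell AbelianAll (ALL ABELIAN VARIETIES), André axis, part XXVIII-e — W₆ FROM THE MIDDLE DEGREE ALONE:
# `WeilSixfolds ⟸ (W_E)₃ ∧ [on every compact pencil of abelian sixfolds with an `E`-power fibre: the lift (L)_t(3) at that fibre]`,
# equivalently `⟸ (W_E)₃ ∧ [(N₃ f) at some fibre]`, equivalently `⟸ (W_E)₃ ∧ [ONE algebraic 7-cycle on `𝒳 × 𝒳` acting on `H⁶(𝒳)` as a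
# Leray idempotent with image spanned by algebraic 3-cycles]` — no hypothesis in degrees `2`, `4`, `8`, `10`

HONEST FRAMING (page 1, verbatim): **research route, not a corollary; conditional on HC_CM plus one named
minimal statement.** Cell line: research route conditional on HC_CM; not a corollary; Q11.4-sentence-2
already refuted in dim ≥ 3. Nothing in this file proves a case of the Hodge conjecture for an abelian variety; `HC_CM` does not occur in
this file (it is IDLE on the W₆ rows: the `E`-power fibre carries Tate's theorem); item `Theses.RankFourFaces.CMToAbelian` (stmt-16267) and
the Weil-sixfold item `Theses.SevenfoldWeilCensus.WeilSixfolds` (stmt-2524) OPEN and not closed here — `(W_E)₃` is an OPEN habitat node.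
Seat `pub-hodge-ring2-ab-andre-2`, gen 20; brief (iii) "smallest open instance stated as a find-the-cycle problem".

## What this file proves (theorems only; no definition, no named fact, no sorry)

The W₆ rows of the André axis so far asked, per `E`-power-pointed (or CM-pointed) compact pencil of abelian sixfolds, hypotheses in SEVERAL
degrees: `NumE[6,3,3]` (part XIX-f; degree `(3,3)` only but in "hom ≡ num" form), `PrimE[6]` (degrees `4` and `6`), (N₁) ∧ (N₂) ∧ (N₃)
(part XIV-g), rank one in degrees `2`, `4` ∧ (N₃) (part XIV-h), idempotents with HC for their images in ALL degrees `2p ≤ 12` (part XXVII-c).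
Here, with the tree's transport-out-of-one-fibre (part XIX-f `map_fiberι_mem_algebraicClasses_of_comap_le_sup`) and part XXVIII:

* `mem_algebraicClasses_of_cmPowerWeilPencilsAt_of_lift` — CORE LEMMA in relative dimension `2n`: `(W_E)ₙ` ∧ [(L)_t(n) at the `E`-power
  points of the compact pencils of abelian `2n`-folds] ⟹ every rational `(n,n)` Weil class on an abelian `2n`-fold of Weil type is algebraic
  (`W|_{X_t}` is algebraic by Tate, the lift at `t` transports it to `X_s ≅ A`).
* **`weilSixfolds_of_cmPowerWeilPencilsAt_of_lift_three`** — `WeilSixfolds ⟸ (W_E)₃ ∧ [(L)_t(3) at every `E`-power point of every compact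
  pencil of abelian sixfolds]`; `weilClassesImaginaryQuadratic_of_cmPowerWeilPencils_of_lift` (all `n ≥ 2`).
* **`weilSixfolds_of_cmPowerWeilPencilsAt_of_algebraicInvariantClassesAt_three`** — `⟸ (W_E)₃ ∧ [every compact pencil of abelian sixfolds with
  an `E`-power fibre has SOME fibre `t₀` with (N₃ f)(t₀)]` (part XIV-g's row WITHOUT its (N₁), (N₂); part XIV-h's WITHOUT its rank-one clauses;
  (N₃) is point-free and gives (L) at the `E`-power point).
* **`weilSixfolds_of_cmPowerWeilPencilsAt_of_idempotentPackage_three`** — `⟸ (W_E)₃ ∧ [every such pencil carries, at some point, ONE endomorphism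
  of `H⁶(𝒳(ℂ); ℂ)` induced by an algebraic 7-cycle on `𝒳 × 𝒳` with `j^* e = j^*`, `e|ker j^* = 0` and image inside `N³(𝒳)`]` (part XXVIII-d:
  the package IS (N₃)). FIND-THE-CYCLE for W₆, final form of this column: per `E`-power-pointed pencil of abelian sixfolds, ONE algebraic
  7-cycle on the 14-fold `𝒳 × 𝒳` whose action on `H⁶` of the sevenfold is a Leray idempotent with image spanned by algebraic 3-cycles —
  nothing in degrees `2, 4, 8, 10, 12`.

## Honest status

No node is born; nothing is minimal; nothing is closed: `(W_E)₃` (`CMPowerAnchoredCompactWeilPencilsAt 3`, part IX) is an OPEN habitat node and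
the bracket is where the Weil classes hide. `HC_CM` idle; no named fact. The rows are weaker-or-equal (fewer hypotheses) than parts XIV-g/h and
XXVII-c's W₆ rows; against part XIX-f's `NumE[6,3,3]` row they are the lift / idempotent spelling of the same degree-`(3,3)` statement.

References: vanGeemen1994HodgeAV (Lemma 3.7, Thm. 4.3, 5.12, Thm. 6.12); Andre1996Motifs (§6.3, Lemme 6.3.3, Remarque 2); Milne2020HodgeClassesAV
(proof of Prop. 1); DeningerMurre1991 (Thm. 3.1); Abdulali1994FamiliesAV (Thm. 5.5); Weil1977HodgeRing.
-/

noncomputable section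

set_option linter.dupNamespace false

namespace Summit.HodgeConjecture.HodgeConjecture.Ring2.AbelianAll

open CategoryTheory AlgebraicGeometry
open Literature.AlgebraicGeometry Literature.AlgebraicGeometry.Motives
open Literature.AlgebraicGeometry.HodgeTheory
open Summit.HodgeConjecture.HodgeConjecture
open Summit.HodgeConjecture.HodgeConjecture.Theses
open Summit.HodgeConjecture.HodgeConjecture.Ring2.Hypotheses (cmPowerLocus cmPowerAnchor_valid)
open Summit.HodgeConjecture.HodgeConjecture.WeilTypeLadder (WeilClassesImaginaryQuadratic NonsplitSixfolds
  weilSixfolds_iff_weilClassesOf nonsplitSixfolds_of_weilSixfolds)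

variable {𝒳 S : SchemeOver ℂ}

/-! ## §1 Core lemma: (W_E)ₙ and the lift in the middle degree at the `E`-power points -/

/-- **CORE LEMMA (NO `HC_CM`, NO named fact).** Granted `(W_E)ₙ` and the André-axis lift (L)_t(n) IN THE MIDDLE DEGREE at the `E`-power points of
the compact pencils of abelian `2n`-folds, every rational `(n,n)` Weil class on an abelian `2n`-fold of Weil type is algebraic: on the pencil of
`(W_E)ₙ` through `A ≅ X_s`, the global class `W` restricts on the `E`-power fibre `X_t` to a rational `(n,n)` class, algebraic by Tate's theorem
(`cmPowerAnchor_valid`); (L)_t(n) writes `W = η + κ` with `η ∈ Nⁿ(𝒳)` and `j_t^* κ = 0`, hence `j_s^* κ = 0` and `j_s^* W = j_s^* η` is algebraic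
(part XIX-f `map_fiberι_mem_algebraicClasses_of_comap_le_sup`); the chart reads `c`. [cite: vanGeemen1994HodgeAV, Lemma 3.7 and Thm. 4.3]
[cite: Andre1996Motifs, §6.3 a) and c) (p. 33)] [cite: Milne2020HodgeClassesAV, Prop. 1 (p. 7)] -/
theorem mem_algebraicClasses_of_cmPowerWeilPencilsAt_of_lift {n : ℕ} (hW : CMPowerAnchoredCompactWeilPencilsAt n)
    (hL : ∀ ⦃𝒳 S : SchemeOver ℂ⦄ (f : 𝒳 ⟶ S) (hf : IsCompactAbelianPencil f (2 * n)) (t : ComplexPoints S),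
      t ∈ cmPowerLocus f (2 * n) →
        (algebraicClasses (fiberOver f t) n).comap (complexBetti.map (fiberι f t) (2 * n)).hom ≤
          algebraicClasses 𝒳 n ⊔ LinearMap.ker (complexBetti.map (fiberι f t) (2 * n)).hom)
    {d : ℕ} (hd : 0 < d) {A : AbelianVariety ℂ} {φ : A ⟶ A}
    (hAdim : A.dim = 2 * n) (hA : IsSmoothProjective (2 * n) A.X) (hφ : φ ≫ φ = -(d • 𝟙 A))
    {c : complexBetti A.X (2 * n)} (hcQ : IsRationalClass c) (hcH : IsOfHodgeType (2 * n) A.X (2 * n) n n c)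
    (hcW : c ∈ weilClassesOf A φ n d) : c ∈ algebraicClasses A.X n := by
  by_cases hc0 : c = 0
  · rw [hc0]; exact Submodule.zero_mem _
  obtain ⟨𝒳, S, f, hf, s, t, W, e₁, hWH, hread, ht⟩ := hW d hd A φ hAdim hA hφ c hcQ hcH hcW hc0
  have h₀ : complexBetti.map (fiberι f t) (2 * n) W ∈ algebraicClasses (fiberOver f t) n :=
    cmPowerAnchor_valid n (fiberOver f t) _ ht (hWH t).1 (hWH t).2
  have h₁ := map_fiberι_mem_algebraicClasses_of_comap_le_sup hf (hL f hf t ht) h₀ s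
  rw [← hread]
  exact (mem_algebraicClasses_map_iff_of_iso e₁).2 h₁

/-! ## §2 The W₆ rows from the middle degree alone -/

/-- **`WeilSixfolds ⟸ (W_E)₃ ∧ [(L)_t(3) at every `E`-power point of every compact pencil of abelian sixfolds]`** — the Weil-sixfold item
(stmt-HodgeConjecture-2524) from the André-axis lift IN DEGREE `6` ONLY. NO `HC_CM`, NO named fact; nothing is closed — `(W_E)₃` is an OPEN habitat
node. research route, not a corollary; conditional on HC_CM plus one named minimal statement (here `HC_CM` is IDLE).
[cite: vanGeemen1994HodgeAV, Thm. 4.3 and 5.12] [cite: Andre1996Motifs, Lemme 6.3.3 (p. 33) and Remarque 2] -/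
theorem weilSixfolds_of_cmPowerWeilPencilsAt_of_lift_three (hW : CMPowerAnchoredCompactWeilPencilsAt 3)
    (hL : ∀ ⦃𝒳 S : SchemeOver ℂ⦄ (f : 𝒳 ⟶ S) (hf : IsCompactAbelianPencil f 6) (t : ComplexPoints S), t ∈ cmPowerLocus f 6 →
      (algebraicClasses (fiberOver f t) 3).comap (complexBetti.map (fiberι f t) (2 * 3)).hom ≤
        algebraicClasses 𝒳 3 ⊔ LinearMap.ker (complexBetti.map (fiberι f t) (2 * 3)).hom) :
    Theses.SevenfoldWeilCensus.WeilSixfolds :=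
  weilSixfolds_iff_weilClassesOf.2 fun _ hd _ _ hAdim hA hφ _ hcQ hcH hcW ↦
    mem_algebraicClasses_of_cmPowerWeilPencilsAt_of_lift (n := 3) hW hL hd hAdim hA hφ hcQ hcH hcW

/-- The same for the NON-SPLIT sixfolds. [cite: Andre1996Motifs, Lemme 6.3.3 (p. 33)] -/
theorem nonsplitSixfolds_of_cmPowerWeilPencilsAt_of_lift_three (hW : CMPowerAnchoredCompactWeilPencilsAt 3)
    (hL : ∀ ⦃𝒳 S : SchemeOver ℂ⦄ (f : 𝒳 ⟶ S) (hf : IsCompactAbelianPencil f 6) (t : ComplexPoints S), t ∈ cmPowerLocus f 6 →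
      (algebraicClasses (fiberOver f t) 3).comap (complexBetti.map (fiberι f t) (2 * 3)).hom ≤
        algebraicClasses 𝒳 3 ⊔ LinearMap.ker (complexBetti.map (fiberι f t) (2 * 3)).hom) :
    NonsplitSixfolds :=
  nonsplitSixfolds_of_weilSixfolds (weilSixfolds_of_cmPowerWeilPencilsAt_of_lift_three hW hL)

/-- **R∞ from the middle degree**: `(∀ n ≥ 2, (W_E)ₙ) ∧ (∀ n ≥ 2, (L)_t(n) at the `E`-power points of the compact pencils of abelian
`2n`-folds) ⟹` every Weil class over every imaginary quadratic field is algebraic. NO `HC_CM`, NO named fact. [cite: Weil1977HodgeRing]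
[cite: vanGeemen1994HodgeAV, Thm. 4.3] -/
theorem weilClassesImaginaryQuadratic_of_cmPowerWeilPencils_of_lift (hW : ∀ n, 2 ≤ n → CMPowerAnchoredCompactWeilPencilsAt n)
    (hL : ∀ n, 2 ≤ n → ∀ ⦃𝒳 S : SchemeOver ℂ⦄ (f : 𝒳 ⟶ S) (hf : IsCompactAbelianPencil f (2 * n)) (t : ComplexPoints S),
      t ∈ cmPowerLocus f (2 * n) →
        (algebraicClasses (fiberOver f t) n).comap (complexBetti.map (fiberι f t) (2 * n)).hom ≤
          algebraicClasses 𝒳 n ⊔ LinearMap.ker (complexBetti.map (fiberι f t) (2 * n)).hom) :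
    WeilClassesImaginaryQuadratic :=
  fun n hn _ hd _ _ hAdim hA hφ _ hcQ hcH hcW ↦
    mem_algebraicClasses_of_cmPowerWeilPencilsAt_of_lift (hW n hn) (hL n hn) hd hAdim hA hφ hcQ hcH hcW

/-- **`WeilSixfolds ⟸ (W_E)₃ ∧ [every compact pencil of abelian sixfolds with an `E`-power fibre has SOME fibre `t₀` at which every invariant
class of degree `6` is the restriction of an algebraic 3-cycle of the sevenfold — (N₃ f)(t₀)]`.** Part XIV-g's row WITHOUT its hypotheses (N₁),
(N₂); part XIV-h's WITHOUT its rank-one clauses; quantified over `E`-power-pointed pencils only: (N₃) is point-free (part XIV-f) and gives (L)_t(3)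
at the `E`-power point (part XXVIII-a). NO `HC_CM`, NO named fact; nothing is closed. research route, not a corollary; conditional on HC_CM plus one
named minimal statement (here `HC_CM` is IDLE). [cite: Abdulali1994FamiliesAV, Theorem 5.5 (p. 1130)] [cite: vanGeemen1994HodgeAV, Thm. 4.3 and 5.12]
[cite: Andre1996Motifs, Lemme 6.3.3 (p. 33) and Remarque 2] -/
theorem weilSixfolds_of_cmPowerWeilPencilsAt_of_algebraicInvariantClassesAt_three (hW : CMPowerAnchoredCompactWeilPencilsAt 3)
    (hN : ∀ ⦃𝒳 S : SchemeOver ℂ⦄ ⦃f : 𝒳 ⟶ S⦄ (hf : IsCompactAbelianPencil f 6), (cmPowerLocus f 6).Nonempty →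
      ∃ t₀ : ComplexPoints S, AlgebraicInvariantClassesAt hf t₀ 3) :
    Theses.SevenfoldWeilCensus.WeilSixfolds := by
  refine weilSixfolds_of_cmPowerWeilPencilsAt_of_lift_three hW fun 𝒳 S f hf t ht ↦ ?_
  obtain ⟨t₀, h₀⟩ := hN hf ⟨t, ht⟩
  exact comap_le_sup_of_range_le_map t
    ((algebraicInvariantClassesAt_iff_range_le_map hf t 3).1 (algebraicInvariantClassesAt_of_at hf h₀ t))

/-- The same for the NON-SPLIT sixfolds. [cite: Andre1996Motifs, Lemme 6.3.3 (p. 33)] -/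
theorem nonsplitSixfolds_of_cmPowerWeilPencilsAt_of_algebraicInvariantClassesAt_three (hW : CMPowerAnchoredCompactWeilPencilsAt 3)
    (hN : ∀ ⦃𝒳 S : SchemeOver ℂ⦄ ⦃f : 𝒳 ⟶ S⦄ (hf : IsCompactAbelianPencil f 6), (cmPowerLocus f 6).Nonempty →
      ∃ t₀ : ComplexPoints S, AlgebraicInvariantClassesAt hf t₀ 3) :
    NonsplitSixfolds :=
  nonsplitSixfolds_of_weilSixfolds (weilSixfolds_of_cmPowerWeilPencilsAt_of_algebraicInvariantClassesAt_three hW hN)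

/-- **W₆ IN IDEMPOTENT FORM, DEGREE 6 ONLY: `WeilSixfolds ⟸ (W_E)₃ ∧ [every compact pencil of abelian sixfolds with an `E`-power fibre carries,
at some point `t₀`, ONE endomorphism of `H⁶(𝒳(ℂ); ℂ)` induced by an algebraic 7-cycle on `𝒳 × 𝒳` with `j_{t₀}^* e = j_{t₀}^*`, `e|ker j_{t₀}^* = 0`
and image inside `N³(𝒳)`]`** (part XXVIII-d: the package IS (N₃ f)(t₀)). Part XXVII-c's W₆ row asked idempotents and HC for their images in ALL
degrees `2p ≤ 12` at ALL `E`-power points. FIND-THE-CYCLE, final form of this column: per pencil, one algebraic 7-cycle on the 14-fold `𝒳 × 𝒳`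
acting on `H⁶` of the sevenfold as a Leray idempotent whose image is spanned by algebraic 3-cycles. NO `HC_CM`, NO named fact; nothing is closed.
research route, not a corollary; conditional on HC_CM plus one named minimal statement (here `HC_CM` is IDLE).
[cite: DeningerMurre1991, Thm. 3.1 and Cor. 3.2] [cite: vanGeemen1994HodgeAV, Thm. 4.3, 5.12 and Thm. 6.12] [cite: Andre1996Motifs, Lemme 6.3.3 (p. 33)] -/
theorem weilSixfolds_of_cmPowerWeilPencilsAt_of_idempotentPackage_three (hW : CMPowerAnchoredCompactWeilPencilsAt 3)
    (hE : ∀ ⦃𝒳 S : SchemeOver ℂ⦄ ⦃f : 𝒳 ⟶ S⦄ (_ : IsCompactAbelianPencil f 6), (cmPowerLocus f 6).Nonempty →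
      ∃ (t₀ : ComplexPoints S) (e : complexBetti 𝒳 (2 * 3) →ₗ[ℂ] complexBetti 𝒳 (2 * 3)),
        IsAlgebraicCorrespondence (6 + 1) (6 + 1) 𝒳 𝒳 e ∧
        (∀ w, complexBetti.map (fiberι f t₀) (2 * 3) (e w) = complexBetti.map (fiberι f t₀) (2 * 3) w) ∧
        (∀ w, complexBetti.map (fiberι f t₀) (2 * 3) w = 0 → e w = 0) ∧
        (∀ w, e w ∈ algebraicClasses 𝒳 3)) :
    Theses.SevenfoldWeilCensus.WeilSixfolds := by
  refine weilSixfolds_of_cmPowerWeilPencilsAt_of_algebraicInvariantClassesAt_three hW fun 𝒳 S f hf hne ↦ ?_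
  obtain ⟨t₀, e, h₁, h₂, h₃, h₄⟩ := hE hf hne
  exact ⟨t₀, (algebraicInvariantClassesAt_iff_exists_lerayIdempotentC hf t₀ (show 3 + 3 = 6 by rfl)).2 ⟨e, h₁, h₂, h₃, h₄⟩⟩

/-- The same for the NON-SPLIT sixfolds. [cite: Andre1996Motifs, Lemme 6.3.3 (p. 33)] -/
theorem nonsplitSixfolds_of_cmPowerWeilPencilsAt_of_idempotentPackage_three (hW : CMPowerAnchoredCompactWeilPencilsAt 3)
    (hE : ∀ ⦃𝒳 S : SchemeOver ℂ⦄ ⦃f : 𝒳 ⟶ S⦄ (_ : IsCompactAbelianPencil f 6), (cmPowerLocus f 6).Nonempty →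
      ∃ (t₀ : ComplexPoints S) (e : complexBetti 𝒳 (2 * 3) →ₗ[ℂ] complexBetti 𝒳 (2 * 3)),
        IsAlgebraicCorrespondence (6 + 1) (6 + 1) 𝒳 𝒳 e ∧
        (∀ w, complexBetti.map (fiberι f t₀) (2 * 3) (e w) = complexBetti.map (fiberι f t₀) (2 * 3) w) ∧
        (∀ w, complexBetti.map (fiberι f t₀) (2 * 3) w = 0 → e w = 0) ∧
        (∀ w, e w ∈ algebraicClasses 𝒳 3)) :
    NonsplitSixfolds :=
  nonsplitSixfolds_of_weilSixfolds (weilSixfolds_of_cmPowerWeilPencilsAt_of_idempotentPackage_three hW hE)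

end Summit.HodgeConjecture.HodgeConjecture.Ring2.AbelianAll

end
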